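import Summits.CriticalPhenomena.PercolationContinuityZ3.Theorems.PercNearOneGluingNoHeavyLowerTailSahiFreeSlotFourMono
import Summits.CriticalPhenomena.PercolationContinuityZ3.Theorems.PercNearOneGluingNoHeavyLowerTailSahiCombTensorisation
import Summits.CriticalPhenomena.PercolationContinuityZ3.Theorems.PercNearOneGluingNoHeavyLowerTailSahiFreeSlotFourPeel
import Summits.CriticalPhenomena.PercolationContinuityZ3.Theorems.PercNearOneGluingNoHeavyLowerTailSahiFreeSlotFourCert
import HarnessLib

/-!
# `NoHeavyLowerTail` (stmt-CriticalPhenomena-4575) — TOP-REGION PEELING at order 4 for every product measure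

Support file, seat `prim-l12-p5` (gen 18), `--supports stmt-CriticalPhenomena-4575`.  Standard axioms (the imported certificates
`…SahiFreeSlotFourCert`, `…SahiFreeSlotFourPeel` are `native_decide` files); no sorries, no named facts.
THEOREM (`bernoulliWeight_sahiE4_peel_top`; memo FROM-prim-l12-p5-g18-TOP-PEELING Theorem 1, proof note PEELING-PROOF-g18.md §3–4): for a product
measure `μ_p` on `Set ι`, finite `A_0, A_1, A_2 ⊆ ι`, `K := A_0 ∩ A_1 ∩ A_2` (= `region A 6`, the coins common to all three), `m = rr p A` the seven region
closed-probabilities and `m' = m[6 ↦ 1]`, and every monotone `f ≥ 0`: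
   `z_O(m) · E_4^{μ_{p[K↦0]}}(f; 1_{H_{A_0}},1_{H_{A_1}},1_{H_{A_2}}) ≤ z_O(m') · E_4^{μ_p}(f; 1_{H_{A_0}},1_{H_{A_1}},1_{H_{A_2}})`,
where `p[K↦0]` (`killF p K`) switches the common coins off (so the hits become `H_{A_j ∖ K}` and `f` is seen through `ω ↦ ω ∖ K`) and `z_O = zWK univ`
is gen 17's free-slot density on the full pattern (`z_O ≥ 0`, `…SahiFreeSlotFourPeel`).  So positivity of `E_4` with a free monotone slot transfers
from the TOP-FREE configuration to the configuration — the order-4 instance of "F(n+1,1)∀X ⟺ its top-free case".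
INGREDIENTS: the product-measure factorisation `E_p[φ(ω∖K)·1_{K∩ω=∅}] = (Π_{c∈K}(1−p_c))·E_p[φ(ω∖K)]` (`ex_diff_mul_missInd`), the kill/push-forward
identity (`ex_killF`), the two cell facts (F1) `v_R(p) = m_6·v_R(p[K↦0])` and (F2) `v_{R∪{6}}(p) ≥ (1−m_6)·v_R(p[K↦0])` for `6 ∉ R` (monotone `f`), gen 17's
cell decomposition `E_4 = Σ_R z_{patt R}(m)·v_R` (`sahiE4_eq_sum_z_vcell`), and the certified pattern inequality `peel_pattern_ineq_four`
(`z_O(m)·z_W(m') ≤ z_O(m')·(m_6 z_W(m) + (1−m_6) z_O(m))`); the comparison is then TERMWISE over the cells `R ∌ 6`. [this work]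
-/

open scoped Classical

namespace Summit.CriticalPhenomena.PercolationContinuityZ3.Theorems

namespace SahiFreeSlot

open Finset Function Literature.Combinatorics.Sahi2008 SahiHitting
open Literature.Probability.Percolation.DecisionTree (ind ind_of_mem ind_of_not_mem ind_nonneg)

variable {ι : Type} [Fintype ι]

/-- One closed coin factorises: `E_p[ψ(ω ∖ {e})·1_{e ∉ ω}] = (1 − p_e)·E_p[ψ(ω ∖ {e})]`. [folklore] -/
theorem ex_diff_singleton_mul_notMem (p : ι → unitInterval) (e : ι) (ψ : Set ι → ℝ) :
    ex (bernoulliWeight p) (fun ω => ψ (ω \ {e}) * (if e ∈ ω then 0 else 1)) =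
      (1 - (p e : ℝ)) * ex (bernoulliWeight p) (fun ω => ψ (ω \ {e})) := by
  have h1 := ex_update_eq p e (p e) (fun ω => ψ (ω \ {e}) * (if e ∈ ω then 0 else 1))
  have h2 := ex_update_eq p e (p e) (fun ω => ψ (ω \ {e}))
  rw [update_eq_self] at h1 h2
  have hsecT : secEx p e (fun ω => ψ (ω \ {e}) * (if e ∈ ω then 0 else 1)) true = 0 := by
    simp only [secEx]
    exact Finset.sum_eq_zero fun ω _ => by simp
  have hsecF : secEx p e (fun ω => ψ (ω \ {e}) * (if e ∈ ω then 0 else 1)) false =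
      secEx p e (fun ω => ψ (ω \ {e})) false := by
    simp only [secEx]
    refine Finset.sum_congr rfl fun ω hω => ?_
    have hω' : e ∉ ω := (Finset.mem_filter.1 hω).2
    simp [hω']
  have hsecF' : secEx p e (fun ω => ψ (ω \ {e})) true = secEx p e (fun ω => ψ (ω \ {e})) false := by
    simp only [secEx]
    refine Finset.sum_congr rfl fun ω hω => ?_
    have hω' : e ∉ ω := (Finset.mem_filter.1 hω).2
    simp only [if_true, Bool.false_eq_true, if_false]
    rw [Set.insert_sdiff_of_mem _ (Set.mem_singleton e)]
  rw [h1, h2, hsecT, hsecF, hsecF']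
  ring

/-- **Closed coins factorise**: `E_p[φ(ω ∖ K)·1_{K ∩ ω = ∅}] = (∏_{c∈K}(1 − p_c))·E_p[φ(ω ∖ K)]` (product structure). [folklore] -/
theorem ex_diff_mul_missInd (K : Finset ι) : ∀ (p : ι → unitInterval) (φ : Set ι → ℝ),
    ex (bernoulliWeight p) (fun ω => φ (ω \ ↑K) * ind {ω : Set ι | ∀ c ∈ K, c ∉ ω} ω) =
      (∏ c ∈ K, (1 - (p c : ℝ))) * ex (bernoulliWeight p) (fun ω => φ (ω \ ↑K)) := by
  induction K using Finset.induction_on with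
  | empty =>
    intro p φ
    have h : ∀ ω : Set ι, ind {ω : Set ι | ∀ c ∈ (∅ : Finset ι), c ∉ ω} ω = 1 := fun ω => ind_of_mem (by simp)
    simp only [h, mul_one, Finset.prod_empty, one_mul, Finset.coe_empty, Set.sdiff_empty]
  | insert a K haK ih =>
    intro p φ
    set ψ : Set ι → ℝ := fun ω' => φ (ω' \ ↑K) * ind {ω : Set ι | ∀ c ∈ K, c ∉ ω} ω' with hψ
    have hdiff : ∀ ω : Set ι, ω \ ↑(insert a K) = (ω \ {a}) \ ↑K := fun ω => by
      rw [Finset.coe_insert, Set.insert_eq, Set.sdiff_sdiff]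
    -- peel the coin `a` pointwise
    have hstep : (fun ω : Set ι => φ (ω \ ↑(insert a K)) * ind {ω : Set ι | ∀ c ∈ insert a K, c ∉ ω} ω)
        = fun ω => ψ (ω \ {a}) * (if a ∈ ω then 0 else 1) := by
      funext ω
      by_cases ha : a ∈ ω
      · have h0 : ind {ω : Set ι | ∀ c ∈ insert a K, c ∉ ω} ω = 0 :=
          ind_of_not_mem fun h => h a (Finset.mem_insert_self a K) ha
        rw [h0, if_pos ha, mul_zero, mul_zero]
      · rw [if_neg ha, mul_one, hψ]
        simp only []
        rw [Set.sdiff_singleton_eq_self ha, hdiff ω, Set.sdiff_singleton_eq_self ha]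
        congr 1
        by_cases hK : ∀ c ∈ K, c ∉ ω
        · have hmem : ω ∈ {ω : Set ι | ∀ c ∈ insert a K, c ∉ ω} := fun c hc =>
            (Finset.mem_insert.1 hc).elim (fun h => h ▸ ha) (fun h => hK c h)
          rw [ind_of_mem hmem, ind_of_mem (show ω ∈ {ω : Set ι | ∀ c ∈ K, c ∉ ω} from hK)]
        · rw [ind_of_not_mem (show ω ∉ {ω : Set ι | ∀ c ∈ insert a K, c ∉ ω} from fun h =>
              hK fun c hc => h c (Finset.mem_insert_of_mem hc)),
            ind_of_not_mem (show ω ∉ {ω : Set ι | ∀ c ∈ K, c ∉ ω} from hK)]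
    rw [hstep, ex_diff_singleton_mul_notMem p a ψ, ← SahiCombTensor.ex_bernoulliWeight_update_zero p a ψ, hψ,
      ih (update p a 0) φ]
    have hprod : ∏ c ∈ K, (1 - ((update p a 0 c : unitInterval) : ℝ)) = ∏ c ∈ K, (1 - (p c : ℝ)) :=
      Finset.prod_congr rfl fun c hc => by
        have hca : c ≠ a := fun h => haK (h ▸ hc)
        rw [update_of_ne hca]
    rw [hprod, SahiCombTensor.ex_bernoulliWeight_update_zero p a, Finset.prod_insert haK]
    have hd2 : (fun ω : Set ι => φ ((ω \ {a}) \ ↑K)) = fun ω => φ (ω \ ↑(insert a K)) := by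
      funext ω; rw [hdiff ω]
    rw [hd2]
    ring

section Model

/-- Switch off the coins of a finite set `K` (open-probability `0`). [this work] -/
noncomputable def killF (p : ι → unitInterval) (K : Finset ι) : ι → unitInterval := fun c => if c ∈ K then 0 else p c

/-- Killing `K` is the push-forward of `μ_p` under `ω ↦ ω ∖ K`: `E_{p[K↦0]}[h] = E_p[h(· ∖ K)]`. [folklore] -/
theorem ex_killF (p : ι → unitInterval) (K : Finset ι) (h : Set ι → ℝ) :
    ex (bernoulliWeight (killF p K)) h = ex (bernoulliWeight p) (fun ω => h (ω \ ↑K)) := by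
  induction K using Finset.induction_on generalizing h with
  | empty =>
    have : killF p ∅ = p := funext fun c => by simp [killF]
    simp [this]
  | insert a K haK ih =>
    have hupd : killF p (insert a K) = update (killF p K) a 0 := by
      funext c
      by_cases hca : c = a
      · subst hca; simp [killF]
      · rw [update_of_ne hca]; simp [killF, hca]
    rw [hupd, SahiCombTensor.ex_bernoulliWeight_update_zero, ih]
    refine congrArg _ (funext fun ω => ?_)
    rw [Finset.coe_insert, Set.insert_eq, Set.sdiff_sdiff, Set.union_comm]

/-- The region probabilities after killing the top region `K = region A 6`: `rr` with `rr_6 := 1`. [this work] -/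
theorem rr_killF_top (p : ι → unitInterval) (A : Fin 3 → Finset ι) :
    rr (killF p (region A 6)) A = Function.update (rr p A) 6 1 := by
  funext i
  by_cases hi : i = 6
  · subst hi
    rw [Function.update_self, rr]
    exact Finset.prod_eq_one fun c hc => by simp [killF, hc]
  · rw [Function.update_of_ne hi, rr, rr]
    refine Finset.prod_congr rfl fun c hc => ?_
    have hc6 : c ∉ region A 6 := fun h6 => Finset.disjoint_left.1 (region_disjoint A hi) hc h6
    simp [killF, hc6]

/-- Removing the coins of the top region deletes `6` from the cell and keeps the other regions. [this work] -/
theorem rho_diff_top (A : Fin 3 → Finset ι) (ω : Set ι) : rho A (ω \ ↑(region A 6)) = (rho A ω).erase 6 := by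
  ext i
  rw [mem_rho, Finset.mem_erase, mem_rho]
  constructor
  · rintro ⟨c, hc, hcω⟩
    rw [Set.mem_sdiff] at hcω
    refine ⟨fun hi => hcω.2 (by rw [hi] at hc; exact hc), c, hc, hcω.1⟩
  · rintro ⟨hi, c, hc, hcω⟩
    exact ⟨c, hc, Set.mem_sdiff_of_mem hcω (fun h6 => Finset.disjoint_left.1 (region_disjoint A hi) hc h6)⟩

/-- `6 ∈ rho ω` iff some coin of the top region is open. [this work] -/
theorem six_mem_rho_iff (A : Fin 3 → Finset ι) (ω : Set ι) :
    (6 : Fin 7) ∈ rho A ω ↔ ¬ (∀ c ∈ region A 6, c ∉ ω) := by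
  rw [mem_rho]; push Not; rfl

/-- **(F1)** For a cell without the top region, `v_R(p) = rr_6 · v_R(p[K↦0])`. [this work] -/
theorem vcell_eq_rr_mul_vcell_kill (p : ι → unitInterval) (f : Set ι → ℝ) (A : Fin 3 → Finset ι) {R : Finset (Fin 7)}
    (hR : (6 : Fin 7) ∉ R) : vcell p f A R = rr p A 6 * vcell (killF p (region A 6)) f A R := by
  unfold vcell
  rw [ex_killF]
  have hpt : (fun ω => f ω * cellInd A R ω)
      = fun ω => (fun ω' => f ω' * cellInd A R ω') (ω \ ↑(region A 6)) * ind {ω : Set ι | ∀ c ∈ region A 6, c ∉ ω} ω := by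
    funext ω
    by_cases hK : ∀ c ∈ region A 6, c ∉ ω
    · have hω : ω \ ↑(region A 6) = ω := sdiff_eq_left.2 (Set.disjoint_left.2 fun c hcω hcK => hK c hcK hcω)
      rw [ind_of_mem (show ω ∈ {ω : Set ι | ∀ c ∈ region A 6, c ∉ ω} from hK), mul_one]
      simp only [hω]
    · have h6 : (6 : Fin 7) ∈ rho A ω := (six_mem_rho_iff A ω).2 hK
      have hc : cellInd A R ω = 0 := by
        unfold cellInd; rw [if_neg]; intro h; rw [h] at h6; exact hR h6
      rw [ind_of_not_mem (show ω ∉ {ω : Set ι | ∀ c ∈ region A 6, c ∉ ω} from hK), hc]; ring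
  have key := ex_diff_mul_missInd (region A 6) p (fun ω' => f ω' * cellInd A R ω')
  rw [hpt]
  beta_reduce
  beta_reduce at key
  rw [key]
  rfl

/-- **(F2)** For a cell without the top region and a monotone `f`, `v_{R ∪ {6}}(p) ≥ (1 − rr_6) · v_R(p[K↦0])`. [this work] -/
theorem vcell_insert_ge (p : ι → unitInterval) {f : Set ι → ℝ} (hf : Monotone f) (A : Fin 3 → Finset ι) {R : Finset (Fin 7)}
    (hR : (6 : Fin 7) ∉ R) : (1 - rr p A 6) * vcell (killF p (region A 6)) f A R ≤ vcell p f A (insert 6 R) := by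
  set K := region A 6 with hKdef
  set φ : Set ι → ℝ := fun ω' => f ω' * cellInd A R ω' with hφ
  -- v_{R∪6}(p) ≥ E_p[φ(ω∖K)·(1 − 1_{K closed})]
  have hpt : ∀ ω : Set ι, φ (ω \ ↑K) * (1 - ind {ω : Set ι | ∀ c ∈ K, c ∉ ω} ω) ≤ f ω * cellInd A (insert 6 R) ω := by
    intro ω
    by_cases hKc : ∀ c ∈ K, c ∉ ω
    · rw [ind_of_mem (show ω ∈ {ω : Set ι | ∀ c ∈ K, c ∉ ω} from hKc), sub_self, mul_zero]
      have hc : cellInd A (insert 6 R) ω = 0 := by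
        unfold cellInd
        rw [if_neg]
        intro h6
        have : (6 : Fin 7) ∈ rho A ω := by rw [h6]; exact Finset.mem_insert_self 6 R
        exact (six_mem_rho_iff A ω).1 this hKc
      rw [hc, mul_zero]
    · rw [ind_of_not_mem (show ω ∉ {ω : Set ι | ∀ c ∈ K, c ∉ ω} from hKc), sub_zero, mul_one, hφ]
      simp only []
      have hrho : cellInd A R (ω \ ↑K) = cellInd A (insert 6 R) ω := by
        unfold cellInd
        rw [hKdef, rho_diff_top]
        have h6 : (6 : Fin 7) ∈ rho A ω := (six_mem_rho_iff A ω).2 hKc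
        by_cases hc : rho A ω = insert 6 R
        · rw [if_pos hc, if_pos]; rw [hc, Finset.erase_insert hR]
        · rw [if_neg hc, if_neg]; intro h; apply hc; rw [← h, Finset.insert_erase h6]
      rw [hrho]
      exact mul_le_mul_of_nonneg_right (hf Set.sdiff_subset) (by unfold cellInd; split_ifs <;> norm_num)
  have hmono := ex_mono (isFKGMeasure_bernoulliWeight p).nonneg hpt
  -- evaluate the left-hand side
  have hlhs : ex (bernoulliWeight p) (fun ω => φ (ω \ ↑K) * (1 - ind {ω : Set ι | ∀ c ∈ K, c ∉ ω} ω))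
      = (1 - rr p A 6) * vcell (killF p K) f A R := by
    have hsub : ex (bernoulliWeight p) (fun ω : Set ι => φ (ω \ ↑K) * (1 - ind {ω : Set ι | ∀ c ∈ K, c ∉ ω} ω))
        = ex (bernoulliWeight p) (fun ω => φ (ω \ ↑K))
          - ex (bernoulliWeight p) (fun ω => φ (ω \ ↑K) * ind {ω : Set ι | ∀ c ∈ K, c ∉ ω} ω) := by
      simp only [ex_def, ← Finset.sum_sub_distrib]
      exact Finset.sum_congr rfl fun ω _ => by ring
    have key := ex_diff_mul_missInd K p φ
    rw [hsub, key, vcell, ex_killF]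
    have : rr p A 6 = ∏ c ∈ K, (1 - (p c : ℝ)) := rfl
    rw [this, hφ]
    ring
  rw [hlhs] at hmono
  exact hmono

/-- Cells containing the top region carry no mass once it is killed. [this work] -/
theorem vcell_kill_eq_zero (p : ι → unitInterval) (f : Set ι → ℝ) (A : Fin 3 → Finset ι) {R : Finset (Fin 7)}
    (hR : (6 : Fin 7) ∈ R) : vcell (killF p (region A 6)) f A R = 0 := by
  apply vcell_eq_zero
  rw [rr_killF_top]
  exact cellProb_update_six_of_mem (rr p A) R hR

/-- gen 17's cell decomposition, packaged: `E_4(f; h_A) = Σ_R z_{patt R}(rr) · v_R`. [this work] -/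
theorem sahiE4_eq_sum_z_vcell (p : ι → unitInterval) (f : Set ι → ℝ) (A : Fin 3 → Finset ι) :
    sahiE (bernoulliWeight p) 4 ![f, ind {ω : Set ι | ∃ a ∈ A 0, a ∈ ω}, ind {ω : Set ι | ∃ a ∈ A 1, a ∈ ω},
      ind {ω : Set ι | ∃ a ∈ A 2, a ∈ ω}] = ∑ R, evalKL 7 (zWK (patt R)) (rr p A) * vcell p f A R := by
  have hN : allNodes.Nodup := by
    have h := freeSlotFour_cert
    rw [Bool.and_eq_true, Bool.and_eq_true] at h
    exact of_decide_eq_true h.1.1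
  have key := sahiE_four_eq_sum_cells (bernoulliWeight p) f
    (ind {ω : Set ι | ∃ a ∈ A 0, a ∈ ω}) (ind {ω : Set ι | ∃ a ∈ A 1, a ∈ ω}) (ind {ω : Set ι | ∃ a ∈ A 2, a ∈ ω})
    (rho A) (gam 0) (gam 1) (gam 2) (ind_hit_eq_gam_rho A 0) (ind_hit_eq_gam_rho A 1) (ind_hit_eq_gam_rho A 2)
    (cellProb (rr p A)) (vcell p f A) (fun R => (ex_cellInd p A R).symm) (fun R => rfl)
  rw [key]
  simp only [zeta_eq hN (rr p A)]

/-- **TOP-REGION PEELING at order 4, for every product measure** (memo FROM-prim-l12-p5-g18-TOP-PEELING, Theorem 1): with `m = rr p A` the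
seven region closed-probabilities, `m' = m[6 ↦ 1]`, `K = region A 6 = A_0 ∩ A_1 ∩ A_2` the common coins and `p[K↦0]` the measure with the
common coins switched off (so `h_{A_j}` becomes `h_{A_j ∖ K}` and `f` is evaluated on `ω ∖ K`): for every monotone `f` (no sign needed on `f`… `f ≥ 0`)
`z_O(m) · E_4^{p[K↦0]}(f; h_A) ≤ z_O(m') · E_4^{p}(f; h_A)`.  Hence F(4,1)∀X for the top-free configuration transfers to the configuration.
[this work] -/
theorem bernoulliWeight_sahiE4_peel_top (p : ι → unitInterval) {f : Set ι → ℝ} (hf : Monotone f) (hf0 : ∀ ω, 0 ≤ f ω)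
    (A : Fin 3 → Finset ι) :
    evalKL 7 (zWK Finset.univ) (rr p A) *
        sahiE (bernoulliWeight (killF p (region A 6))) 4 ![f, ind {ω : Set ι | ∃ a ∈ A 0, a ∈ ω},
          ind {ω : Set ι | ∃ a ∈ A 1, a ∈ ω}, ind {ω : Set ι | ∃ a ∈ A 2, a ∈ ω}] ≤
      evalKL 7 (zWK Finset.univ) (Function.update (rr p A) 6 1) *
        sahiE (bernoulliWeight p) 4 ![f, ind {ω : Set ι | ∃ a ∈ A 0, a ∈ ω},
          ind {ω : Set ι | ∃ a ∈ A 1, a ∈ ω}, ind {ω : Set ι | ∃ a ∈ A 2, a ∈ ω}] := by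
  rw [sahiE4_eq_sum_z_vcell, sahiE4_eq_sum_z_vcell, rr_killF_top]
  set m := rr p A with hm
  set m' := Function.update m 6 1 with hm'
  set v := vcell p f A with hv
  set v0 := vcell (killF p (region A 6)) f A with hv0
  set z : Finset (Fin 7) → ℝ := fun R => evalKL 7 (zWK (patt R)) m with hz
  set z' : Finset (Fin 7) → ℝ := fun R => evalKL 7 (zWK (patt R)) m' with hz'
  set zO := evalKL 7 (zWK Finset.univ) m
  set zO' := evalKL 7 (zWK Finset.univ) m'
  have hmbox : ∀ i, 0 ≤ m i ∧ m i ≤ 1 := fun i => rr_mem_unit p A i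
  have hzO : 0 ≤ zO := zO_four_nonneg m hmbox
  -- split both sums into cells without / with the top region
  have hsplit : ∀ a : Finset (Fin 7) → ℝ, ∑ R, a R = ∑ R ∈ univ.filter (fun R => (6 : Fin 7) ∉ R), (a R + a (insert 6 R)) := by
    intro a
    rw [Finset.sum_add_distrib, ← Finset.sum_filter_add_sum_filter_not univ (fun R : Finset (Fin 7) => (6 : Fin 7) ∉ R)]
    congr 1
    have himg : univ.filter (fun R : Finset (Fin 7) => ¬ (6 : Fin 7) ∉ R) = (univ.filter fun R : Finset (Fin 7) => (6 : Fin 7) ∉ R).image (insert 6) := by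
      ext R
      simp only [Finset.mem_filter, Finset.mem_univ, true_and, not_not, Finset.mem_image]
      constructor
      · intro h6; exact ⟨R.erase 6, Finset.notMem_erase 6 R, Finset.insert_erase h6⟩
      · rintro ⟨S, _, rfl⟩; exact Finset.mem_insert_self 6 S
    rw [himg, Finset.sum_image]
    intro S hS T hT hST
    have hS6 : (6 : Fin 7) ∉ S := (Finset.mem_filter.1 hS).2
    have hT6 : (6 : Fin 7) ∉ T := (Finset.mem_filter.1 hT).2
    rw [← Finset.erase_insert hS6, ← Finset.erase_insert hT6, hST]
  rw [hsplit (fun R => z' R * v0 R), hsplit (fun R => z R * v R), Finset.mul_sum, Finset.mul_sum]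
  refine Finset.sum_le_sum fun R hR => ?_
  have hR6 : (6 : Fin 7) ∉ R := (Finset.mem_filter.1 hR).2
  have hpatt : patt (insert 6 R) = Finset.univ := patt_insert_six R
  have hv0ins : v0 (insert 6 R) = 0 := vcell_kill_eq_zero p f A (Finset.mem_insert_self 6 R)
  have hF1 : v R = m 6 * v0 R := vcell_eq_rr_mul_vcell_kill p f A hR6
  have hF2 : (1 - m 6) * v0 R ≤ v (insert 6 R) := vcell_insert_ge p hf A hR6
  have hv0nn : 0 ≤ v0 R := vcell_nonneg _ hf0 A R
  have hΔ : zO * z' R ≤ zO' * (m 6 * z R + (1 - m 6) * zO) := peel_pattern_ineq_four (patt R) m hmbox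
  have hzins : z (insert 6 R) = zO := by
    show evalKL 7 (zWK (patt (insert 6 R))) m = evalKL 7 (zWK Finset.univ) m
    rw [hpatt]
  -- the R-term: zO·(z'_R v0_R + z'_{R∪6}·0) ≤ zO'·(z_R v_R + zO v_{R∪6})
  have hzO' : 0 ≤ zO' := zO_four_nonneg m' (fun i => by
    by_cases hi : i = 6
    · subst hi; simp [hm']
    · rw [hm', Function.update_of_ne hi]; exact hmbox i)
  rw [hv0ins, mul_zero, add_zero, hzins, hF1]
  have h1 : zO * (z' R * v0 R) ≤ zO' * (m 6 * z R + (1 - m 6) * zO) * v0 R := by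
    calc zO * (z' R * v0 R) = (zO * z' R) * v0 R := by ring
      _ ≤ (zO' * (m 6 * z R + (1 - m 6) * zO)) * v0 R := mul_le_mul_of_nonneg_right hΔ hv0nn
  have h2 : zO' * zO * ((1 - m 6) * v0 R) ≤ zO' * zO * v (insert 6 R) :=
    mul_le_mul_of_nonneg_left hF2 (mul_nonneg hzO' hzO)
  calc zO * (z' R * v0 R) ≤ zO' * (m 6 * z R + (1 - m 6) * zO) * v0 R := h1
    _ = zO' * (z R * (m 6 * v0 R)) + zO' * zO * ((1 - m 6) * v0 R) := by ring
    _ ≤ zO' * (z R * (m 6 * v0 R)) + zO' * zO * v (insert 6 R) := by linarith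
    _ = zO' * (z R * (m 6 * v0 R) + zO * v (insert 6 R)) := by ring

end Model

end SahiFreeSlot
end Summit.CriticalPhenomena.PercolationContinuityZ3.Theorems
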